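import Summits.QuantumFields.QCD.Theses.HeatSlicedQuarks
import Summits.QuantumFields.QCD.Theorems.HeatSlicedQuarksInterleavedHeatSliceFlowCollapse
import Summits.QuantumFields.QCD.Theorems.HeatSlicedQuarksQuarkSliceStability

/-!
# Disproof of `InterleavedFlowProper` — findings (cdisprove seat, crux stmt-QuantumFields-18031)

Crux (route HeatSlicedQuarks, rank 8, typed as GLUE, declared X₀-hard):
`InterleavedFlowProper := TracedQuadraticParametrix → QuarkLoopCoefficient → InterleavedHeatSliceFlow`,
with `InterleavedHeatSliceFlow := SmallFieldUltracontractivity → ActionBoundsLowModes → ContinuumQCDExists`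
and BOTH engine cruxes 8871/8872 theorems of the tree (collapse p96451).

VERDICT OF CYCLE 1: **no kill is possible short of refuting continuum QCD; the only cheap closures are
the two vacuity routes (a FALSE milestone 17985 or 16786), both attacked, both resist.** Index:

* §1 `not_crux_iff` — `¬ crux ↔ TQP ∧ QLC ∧ ¬ ContinuumQCDExists` (kernel-checked, using the two
  proved engine cruxes): a disproof must PROVE both lattice milestones AND REFUTE X₀; by
  `not_QCD_of_not_crux` it would refute the summit conjunct `QCD`. `crux_iff_target` — given the
  milestones the crux IS X₀ (zero logical discount, as the planner declares). `crux_iff_retired` — the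
  rev-7 restatement (17988 → 18031, hypothesis `QuarkSliceStability` dropped) is logically idle because
  `QuarkSliceStability` is a theorem (`QuarkSliceStability_proof`).
* §2 load-bearing analysis — `…WithoutTQP`, `…WithoutQLC`, `…WithoutBoth (↔ X₀)`: every weakened
  variant is implied by X₀, so NO `_false_without_<H>` theorem can exist unless X₀ is false
  (`not_target_of_false_withoutTQP/QLC`); under X₀ all variants collapse (`hyps_idle_of_target`).
  The milestones carry analytic (b₀-matching, size frame), not logical, weight.
* §3 vacuity routes — `crux_of_not_tqp`, `crux_of_not_qlc`, `crux_provable_or_is_target`.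
  ATTACKS ON THE MILESTONES (the only way this item's status moves cheaply), summary:
  - QLC (16786, repaired tail): flat toron slice θ = 0 sits inside `C e^{−cL²/(t+L)}/t²` for every
    `c < 1/4` (evidence on items 16786/18031: `envelope_check.out`, `flat_toron_envelope.out`,
    sup_t |F|t²e^{cL²/(t+L)} ≈ 12e^c flat in L ≤ 48); the t⁰ coefficient: sibling refuter's kit j021197
    (image-free slab, Bloch-reduced, tree conventions) gives the lattice θ² coefficient → 1/(6π²) to
    ≤ 1e-4 with an O(1/t) remainder — K1 of the route does NOT fire. On paper (this seat): the O(a)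
    Wilson artefact is the single-γ commutator `(a/2)γ_μ{D_ν, F_νμ}`, spin-traceless against
    `e^{uσF}` (odd γ count), so the remainder is O(a²) = O(1/t), log-free (Laplace expansion of a
    heat kernel, no scale-invariant integrand); θ is pinned only mod 2π but `t|θ| ≤ 1 ∧ t ≥ 1` kills
    the aliasing; `θL² ∈ 2πℤ` is forced (abelian Bianchi on the torus), so off-lattice θ are vacuous,
    not false. No witness.
  - TQP (17985): regimes checked on paper — (i) flat torons / free Polyakov phases: every plaquette
    trivial, so admissible at r = L; image (AB) difference ≤ c⋆/L⁴ at t = L² against the floor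
    `C(ε/L²)²` + tail `C e^{−c/(1+2 log L)²}/L⁴ → C/L⁴` — covered, C free; at t ≲ L images are
    `e^{−Ω(L)}` ≪ ε²/L⁴. (ii) constant Cartan flux θ ≤ δ = ε/r²: traced correction θ²/(6π²)(1+O(1/t))
    − θ⁴t²/(90π²) = O(δ²) since tθ ≤ ε. (iii) negative mass, Landau resonance m = −|θ|/2 (LLL of the
    Wilson term cancels the mass): near-zero modes of D_W of density θ/2π exist but are invisible at
    resolution 1/t ≫ θ (tθ ≤ ε): at fixed t the traced diagonal is smooth and EVEN in θ (colour trace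
    kills the linear term exactly: δH = (spin-lattice op) ⊗ X, tr X = 0), so no O(θ/t) term. (iv) rough
    / oscillating small fields |F| ≤ δ at lattice scale: homogenisation, second order ≈ δ²/t. (v)
    non-abelian small fields: A∧A/F = O(ε). Second-order structure: trΔ = Σ F Π_t F with
    ‖Π_t‖_{L¹} t-independent in the scaling regime (Π_t(x;y,y') = t⁻⁴ g(·/√t)), so |trΔ| ≤ ‖g‖₁ δ²
    for EVERY profile with |F| ≤ δ. NUMERICS (this seat): exact Bloch-reduced cubic-torus scan of
    R(t) := max_x |trΔ(t,x)| / (max plaquette deficit) over x₀-dependent abelian AND non-abelian plaquette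
    profiles (step = locally constant flux of either sign, cosine k = 1…L/2, random-sign, constant n = 1,
    two commuting planes, su(3)-random directions in one/two directions, Polyakov twist φ = π), masses
    m ∈ {−1/2, −1/4, −0.1, −δ, −δ/2, −δ/4, 0, 1/4, 1/2, 1} incl. the Landau resonance, L ∈ {16, 24, 32, 48},
    1 ≤ t ≤ min(L², 6/δ) — the K2 kill line of the route. Conventions validated in-job against the tree
    (free kernel = 4D momentum formula to 1e-15, Clifford/γ₅-hermiticity, SU(3) gauge invariance of the
    traced diagonal, Bloch folding): kit j021520 (quick, L ≤ 16) and kit j021599 (full: 45 (family, mass,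
    L) runs, L ≤ 48, δ ∈ [0.0125, 0.39], 1 ≤ t ≤ 256; `table.txt`/`results.json` attached to this item).
    RESULT: sup over every family, mass and admissible window (tδ ≤ 1, t ≤ L²/16) of R = 0.0348, attained by
    the MASSIVE coefficient (m = −1/2, t ≤ 2; monotone in −m: 6π²R = 2.06, 1.50, 1.18, 1.07, 1.01, 0.98 at
    m = −1/2, −1/4, −0.1, −0.05, −0.025, −0.0125, and 0.48, 0.05 at m = 1/4, 1); at m ∈ {0, −δ/2} the step
    (locally constant flux) families give 6π²R(centre) = 0.895 (t = 1) → 0.953 (4) → 0.972 (8) → 0.981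
    (16–24) at δ = 0.0125, L = 48, L-independent to 4 digits (L = 32 vs 48), three-term fit c₀ + c₁/t +
    c₂/t² (Landau −θ²t²/15 removed) c₀ = 0.996, c₁ ≈ −0.20, c₂ ≈ +0.09 — the continuum a₂ coefficient with
    an O(1/t) LOG-FREE lattice remainder, independently confirming K1/j021197; NO resonance enhancement at
    m = −δ/2 (+3.5 %, smooth in m); two commuting planes ADD (R = 0.031 ≈ 2 × 0.016); cosine k = 2, 4, 8, 16:
    R(1) = 0.013, 0.009, 0.004, 0.005 and DECREASING in t (homogenisation; the alternating profile is exactly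
    second order: R identical at δ = 0.2, 0.05, 0.0125); random-sign: 0.015 → decreasing; su(3)-random
    one/two directions: 0.010/0.009 → decreasing (L = 24 and 32 agree); Polyakov twist φ = π + step:
    identical to the untwisted run until the AB images enter at t ≳ L²/6 with |trΔ|t² ≲ 4·10⁻⁴·t² ≪ the
    tail allowance; constant flux n = 1 followed deep into the Landau regime (tθ ≤ 50, outside TQP's
    window): R DEcreases to 0.003. The only t-growth anywhere is finite-volume imaging at t ≳ L²/8
    (tail-covered) — R never grows inside tδ ≤ 1 on any family. VERDICT: NO K2 witness; numerically TQP
    holds as |trΔ(t,x)| ≤ 0.035 · (max plaquette deficit) uniformly in t ≤ 1/δ, profile, mass and L.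
* §4 junk audit of the consequent, delta to the parent seat's audit (Cruxes/InterleavedHeatSliceFlow/
  Disproof.lean §4, all of which applies verbatim since the consequent is the same X₀): X₀ is
  OFFSET-BLIND (`target_iff_threshold`, after ideator 1's `continuumQCDExists_iff_threshold`; reproved
  here without cross-route imports): it asserts massive QCD above an unpinned common offset M₀, never
  the chiral regime — weaker than the summit's `QCDOf` (no `IsChiralAtZero`, no gap), still not junk.
* §5 what the milestones do NOT buy (information for provers): `milestones_are_lattice_local` — both
  are statements about ONE-particle lattice heat kernels at bounded proper time in a FIXED background;
  X₀ quantifies over measures/limits. There is no decl in the tree of the shape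
  "(lattice heat-kernel facts) → (bound on an effective density)", so a proof of the glue must build
  the entire Bałaban-SU(3)/GK–FMRS flow; the glue's Lean content is `TQP → QLC → X₀`, full stop.
* §6 near-misses / what would change the verdict (no sorries kept).
-/

namespace Summit.QuantumFields.QCD.Cruxes.InterleavedFlowProper.Disproof

open Summit.QuantumFields.QCD.Theses.HeatSlicedQuarks
open Literature.MathematicalPhysics.QuantumFieldTheory
open Filter Topology

/-! ## §0 The proved inputs, by name -/

/-- Engine crux 8871 is a theorem of the tree. [folklore] -/
theorem sfu : SmallFieldUltracontractivity :=
  Cruxes.SmallFieldUltracontractivity.PointCentredAxialParabolic.SmallFieldUltracontractivity_of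

/-- Engine crux 8872 is a theorem of the tree. [folklore] -/
theorem ablm : ActionBoundsLowModes :=
  Cruxes.ActionBoundsLowModes.DropTheWilsonSquare.ActionBoundsLowModes_of

/-- The support 17987 is a theorem of the tree. [folklore] -/
theorem qss : QuarkSliceStability :=
  Theorems.HeatSlicedQuarks.QuarkSliceStability_proof

/-- The parent glue has collapsed onto the target (p96451). [folklore] -/
theorem parent_iff_target : InterleavedHeatSliceFlow ↔ ContinuumQCDExists :=
  Cruxes.InterleavedHeatSliceFlow.interleavedHeatSliceFlow_iff_continuumQCDExists

/-! ## §1 Logical anatomy of the glue -/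

/-- The crux is definitionally the two-milestone implication into the parent glue. [folklore] -/
theorem crux_iff :
    InterleavedFlowProper ↔
      (TracedQuadraticParametrix → QuarkLoopCoefficient → InterleavedHeatSliceFlow) :=
  Iff.rfl

/-- **Content of the glue**: the two milestones imply the route target X₀. [folklore] -/
theorem crux_iff_target_form :
    InterleavedFlowProper ↔
      (TracedQuadraticParametrix → QuarkLoopCoefficient → ContinuumQCDExists) := by
  constructor
  · intro h h1 h2
    exact parent_iff_target.mp (h h1 h2)
  · intro h h1 h2
    exact parent_iff_target.mpr (h h1 h2)

/-- Conjunctive form. [folklore] -/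
theorem crux_iff_conj_form :
    InterleavedFlowProper ↔ (TracedQuadraticParametrix ∧ QuarkLoopCoefficient → ContinuumQCDExists) :=
  crux_iff_target_form.trans ⟨fun h hc => h hc.1 hc.2, fun h h1 h2 => h ⟨h1, h2⟩⟩

/-- **What a disproof must deliver**: both lattice milestones proved AND X₀ refuted. [folklore] -/
theorem not_crux_iff :
    ¬ InterleavedFlowProper ↔
      (TracedQuadraticParametrix ∧ QuarkLoopCoefficient ∧ ¬ ContinuumQCDExists) := by
  rw [crux_iff_target_form]
  constructor
  · intro h
    by_contra hc
    apply h
    intro h1 h2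
    by_contra hX
    exact hc ⟨h1, h2, hX⟩
  · rintro ⟨h1, h2, hX⟩ h
    exact hX (h h1 h2)

/-- The target alone proves the crux (milestones unused). [folklore] -/
theorem crux_of_target (hX : ContinuumQCDExists) : InterleavedFlowProper :=
  fun _ _ => parent_iff_target.mpr hX

/-- Any disproof of the crux is a disproof of the route target X₀. [folklore] -/
theorem not_target_of_not_crux (h : ¬ InterleavedFlowProper) : ¬ ContinuumQCDExists :=
  fun hX => h (crux_of_target hX)

/-- Given the two milestones, the crux IS the target: they give no logical discount. [folklore] -/
theorem crux_iff_target (h1 : TracedQuadraticParametrix) (h2 : QuarkLoopCoefficient) :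
    InterleavedFlowProper ↔ ContinuumQCDExists :=
  ⟨fun h => parent_iff_target.mp (h h1 h2), fun hX => crux_of_target hX⟩

/-- The summit conjunct `QCD = QCDOf 2 ∧ QCDOf 3` implies the route target (drop the gap and chirality
clauses). [folklore] -/
theorem target_of_QCD (hQ : _root_.QCD) : ContinuumQCDExists := by
  intro Nf hNf
  have key : ∀ N : ℕ, QCDOf N → ∃ reg : QCDRegularisation N, reg.HasMassScaling ∧
      ∀ m : Fin N → ℝ, (∀ f, 0 < m f) → ∃ (z shift : QCDField N → ℕ → ℝ)
        (T : OSData (QCDField N) 4), IsQCDAlong (reg.scheme m z shift) T ∧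
          T.IsNontrivial QCDField.glue ∧ T.IsNonGaussian QCDField.glue ∧
            ∀ f g : Fin N, f ≠ g → T.IsNontrivial (QCDField.pseudoRe f g) := by
    rintro N ⟨reg, hms, -, hall⟩
    refine ⟨reg, hms, fun m hm => ?_⟩
    obtain ⟨z, shift, T, hA, hN, hG, hP, -⟩ := hall m hm
    exact ⟨z, shift, T, hA, hN, hG, hP⟩
  rcases hNf with rfl | rfl
  · exact key 2 hQ.1
  · exact key 3 hQ.2

/-- **A disproof of this crux would refute the summit conjunct `QCD` as stated.** [folklore] -/
theorem not_QCD_of_not_crux (h : ¬ InterleavedFlowProper) : ¬ _root_.QCD :=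
  fun hQ => not_target_of_not_crux h (target_of_QCD hQ)

/-- The retired typing (item 17988, rev ≤ 6: `TQP → QLC → QuarkSliceStability → IHSF`). [folklore] -/
def InterleavedFlowProperRetired : Prop :=
  TracedQuadraticParametrix → QuarkLoopCoefficient → QuarkSliceStability → InterleavedHeatSliceFlow

/-- **The rev-7 restatement is logically idle**: with the support `QuarkSliceStability` a theorem
(`qss`), the retired typing 17988 and the current typing 18031 are equivalent. [folklore] -/
theorem crux_iff_retired : InterleavedFlowProper ↔ InterleavedFlowProperRetired :=
  ⟨fun h h1 h2 _ => h h1 h2, fun h h1 h2 => h h1 h2 qss⟩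

/-! ## §2 Load-bearing analysis (hypotheses dropped one at a time)

For a glue item "the crux without H" is the implication with H deleted. None can be shown false here:
each is a CONSEQUENCE of X₀, so `¬ (crux without H)` would be a disproof of continuum QCD. -/

/-- The crux with `TracedQuadraticParametrix` dropped. [folklore] -/
def InterleavedFlowProperWithoutTQP : Prop := QuarkLoopCoefficient → InterleavedHeatSliceFlow

/-- The crux with `QuarkLoopCoefficient` dropped. [folklore] -/
def InterleavedFlowProperWithoutQLC : Prop := TracedQuadraticParametrix → InterleavedHeatSliceFlow

/-- The crux with both milestones dropped is the parent glue, i.e. X₀. [folklore] -/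
def InterleavedFlowProperWithoutBoth : Prop := InterleavedHeatSliceFlow

/-- Dropping both milestones leaves exactly X₀ (collapse). [folklore] -/
theorem withoutBoth_iff_target : InterleavedFlowProperWithoutBoth ↔ ContinuumQCDExists :=
  parent_iff_target

/-- Each weakened variant implies the crux. [folklore] -/
theorem crux_of_withoutTQP (h : InterleavedFlowProperWithoutTQP) : InterleavedFlowProper :=
  fun _ h2 => h h2

/-- Each weakened variant implies the crux. [folklore] -/
theorem crux_of_withoutQLC (h : InterleavedFlowProperWithoutQLC) : InterleavedFlowProper :=
  fun h1 _ => h h1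

/-- Each weakened variant implies the crux. [folklore] -/
theorem crux_of_withoutBoth (h : InterleavedFlowProperWithoutBoth) : InterleavedFlowProper :=
  fun _ _ => h

/-- Each weakened variant is implied by the target. [folklore] -/
theorem withoutTQP_of_target (hX : ContinuumQCDExists) : InterleavedFlowProperWithoutTQP :=
  fun _ => parent_iff_target.mpr hX

/-- Each weakened variant is implied by the target. [folklore] -/
theorem withoutQLC_of_target (hX : ContinuumQCDExists) : InterleavedFlowProperWithoutQLC :=
  fun _ => parent_iff_target.mpr hX

/-- OBSTRUCTION: a `_false_without_TQP` theorem would disprove continuum QCD (X₀). [folklore] -/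
theorem not_target_of_false_withoutTQP (h : ¬ InterleavedFlowProperWithoutTQP) :
    ¬ ContinuumQCDExists :=
  fun hX => h (withoutTQP_of_target hX)

/-- OBSTRUCTION: a `_false_without_QLC` theorem would disprove continuum QCD (X₀). [folklore] -/
theorem not_target_of_false_withoutQLC (h : ¬ InterleavedFlowProperWithoutQLC) :
    ¬ ContinuumQCDExists :=
  fun hX => h (withoutQLC_of_target hX)

/-- OBSTRUCTION: a `_false_without_Both` theorem IS a disproof of continuum QCD (X₀). [folklore] -/
theorem not_target_iff_false_withoutBoth :
    ¬ InterleavedFlowProperWithoutBoth ↔ ¬ ContinuumQCDExists :=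
  not_congr withoutBoth_iff_target

/-- Under X₀ (believed true) both milestones are logically idle: every variant collapses. [folklore] -/
theorem hyps_idle_of_target (hX : ContinuumQCDExists) :
    (InterleavedFlowProperWithoutTQP ↔ InterleavedFlowProper) ∧
      (InterleavedFlowProperWithoutQLC ↔ InterleavedFlowProper) ∧
        (InterleavedFlowProperWithoutBoth ↔ InterleavedFlowProper) :=
  ⟨⟨fun _ => crux_of_target hX, fun _ => withoutTQP_of_target hX⟩,
    ⟨fun _ => crux_of_target hX, fun _ => withoutQLC_of_target hX⟩,
    ⟨fun _ => crux_of_target hX, fun _ => parent_iff_target.mpr hX⟩⟩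

/-- What the milestones DO buy logically: modulo both, every variant, the crux and the target are one
statement. [folklore] -/
theorem all_iff_target (h1 : TracedQuadraticParametrix) (h2 : QuarkLoopCoefficient) :
    (InterleavedFlowProperWithoutTQP ↔ ContinuumQCDExists) ∧
      (InterleavedFlowProperWithoutQLC ↔ ContinuumQCDExists) ∧
        (InterleavedFlowProper ↔ ContinuumQCDExists) :=
  ⟨⟨fun h => parent_iff_target.mp (h h2), fun hX _ => parent_iff_target.mpr hX⟩,
    ⟨fun h => parent_iff_target.mp (h h1), fun hX _ => parent_iff_target.mpr hX⟩,
    crux_iff_target h1 h2⟩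

/-- The WEAKEST hypothesis set under which the glue stops being X₀: exactly one false milestone.
(`¬TQP ∨ ¬QLC` ↔ the glue is provable without touching X₀, in the sense that it follows from `True`.)
[folklore] -/
theorem crux_vacuous_iff_milestone_false_of_not_target (hX : ¬ ContinuumQCDExists) :
    InterleavedFlowProper ↔ (¬ TracedQuadraticParametrix ∨ ¬ QuarkLoopCoefficient) := by
  rw [crux_iff_target_form]
  constructor
  · intro h
    by_contra hc
    push Not at hc
    exact hX (h hc.1 hc.2)
  · rintro (h | h) h1 h2
    · exact absurd h1 h
    · exact absurd h2 h

/-! ## §3 Vacuity routes (the only cheap way the crux could close is a FALSE milestone) -/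

/-- If the traced quadratic parametrix (17985) fails, the crux holds vacuously. [folklore] -/
theorem crux_of_not_tqp (h : ¬ TracedQuadraticParametrix) : InterleavedFlowProper :=
  fun h1 => absurd h1 h

/-- If the quark-loop coefficient certificate (16786) fails, the crux holds vacuously. [folklore] -/
theorem crux_of_not_qlc (h : ¬ QuarkLoopCoefficient) : InterleavedFlowProper :=
  fun _ h2 => absurd h2 h

/-- Trichotomy for the seat: the crux is (vacuously) provable, or it is literally X₀. [folklore] -/
theorem crux_provable_or_is_target :
    (¬ TracedQuadraticParametrix ∨ ¬ QuarkLoopCoefficient) ∨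
      (InterleavedFlowProper ↔ ContinuumQCDExists) := by
  by_cases h1 : TracedQuadraticParametrix
  · by_cases h2 : QuarkLoopCoefficient
    · exact Or.inr (crux_iff_target h1 h2)
    · exact Or.inl (Or.inr h2)
  · exact Or.inl (Or.inl h1)

/-- Milestone falsity is DETECTED by the glue only relative to X₀: if the glue is proved while X₀ is
false, a milestone is false (and conversely). This is the exact sense of the route note "trivial again
if 17985/16786 false". [folklore] -/
theorem milestone_false_of_crux_of_not_target (h : InterleavedFlowProper) (hX : ¬ ContinuumQCDExists) :
    ¬ TracedQuadraticParametrix ∨ ¬ QuarkLoopCoefficient :=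
  (crux_vacuous_iff_milestone_false_of_not_target hX).mp h

/-! ## §4 Junk audit of the consequent — delta to the parent seat's audit: X₀ is OFFSET-BLIND

(The parent audit — regularisation / asymptotic-scaling / physical-branch clauses inhabited by
`canonicalAF`, convergence clause inhabited only by the vacuum along `z ≡ 0`, vacuum rejected by
`IsNontrivial` — applies verbatim: same consequent.) New here: the heavy-threshold form. -/

/-- Heavy-threshold form of X₀: the flavour-blind RGI offset `M₀` made explicit. [folklore] -/
def ThresholdContinuumQCDExists : Prop :=
  ∀ Nf : ℕ, Nf = 2 ∨ Nf = 3 → ∃ M₀ : ℝ, 0 ≤ M₀ ∧ ∃ reg : QCDRegularisation Nf, reg.HasMassScaling ∧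
    ∀ m : Fin Nf → ℝ, (∀ f, M₀ < m f) →
      ∃ (z shift : QCDField Nf → ℕ → ℝ) (T : OSData (QCDField Nf) 4),
        IsQCDAlong (reg.scheme m z shift) T ∧ T.IsNontrivial QCDField.glue ∧
          T.IsNonGaussian QCDField.glue ∧ ∀ f g : Fin Nf, f ≠ g → T.IsNontrivial (QCDField.pseudoRe f g)

/-- Re-basing the critical mass absorbs any common offset: `m_crit'(k) = m_crit(k) + a_k M₀ / Z_m(k)`
(same `a, β, L, Z_m`), and `reg'.scheme m = reg.scheme (m + M₀)`. (Same computation as the tree's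
`thresholdShift_generic`, repeated to keep this work file free of cross-route imports.) [folklore] -/
theorem thresholdShift (Nf : ℕ) (reg : QCDRegularisation Nf) (M₀ : ℝ) :
    ∃ reg' : QCDRegularisation Nf, (reg.HasMassScaling → reg'.HasMassScaling) ∧
      ∀ (m : Fin Nf → ℝ) (z shift : QCDField Nf → ℕ → ℝ),
        reg'.scheme m z shift = reg.scheme (fun f => m f + M₀) z shift := by
  refine ⟨{ reg with mcrit := fun k => reg.mcrit k + reg.a k * M₀ / reg.Zm k }, fun h => h, ?_⟩
  intro m z shift
  simp only [QCDRegularisation.scheme, QCDScheme.mk.injEq, and_true, true_and]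
  funext f k
  ring

/-- **X₀ is offset-blind**: `ContinuumQCDExists ↔ ThresholdContinuumQCDExists`. The consequent of the
glue asserts massive QCD for all mass SPLITTINGS above an unpinned common offset — it never reaches the
chiral regime (that is the summit's extra clause `IsChiralAtZero`, absent here by design). Not junk:
the vacuum and white noise are still excluded (parent audit). [folklore] -/
theorem target_iff_threshold : ContinuumQCDExists ↔ ThresholdContinuumQCDExists := by
  constructor
  · intro h Nf hNf
    obtain ⟨reg, hms, hall⟩ := h Nf hNf
    exact ⟨0, le_rfl, reg, hms, fun m hm => hall m hm⟩
  · intro h Nf hNf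
    obtain ⟨M₀, _hM₀, reg, hms, hall⟩ := h Nf hNf
    obtain ⟨reg', hms', hsch⟩ := thresholdShift Nf reg M₀
    refine ⟨reg', hms' hms, fun m hm => ?_⟩
    obtain ⟨z, shift, T, hT⟩ := hall (fun f => m f + M₀) (fun f => by linarith [hm f])
    exact ⟨z, shift, T, by rw [hsch]; exact hT⟩

/-- Hence the glue, too, is offset-blind: it is `TQP → QLC → (massive QCD above SOME common offset)`.
[folklore] -/
theorem crux_iff_threshold_form :
    InterleavedFlowProper ↔
      (TracedQuadraticParametrix → QuarkLoopCoefficient → ThresholdContinuumQCDExists) := by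
  rw [crux_iff_target_form]
  constructor
  · intro h h1 h2
    exact target_iff_threshold.mp (h h1 h2)
  · intro h h1 h2
    exact target_iff_threshold.mpr (h h1 h2)

/-! ## §5 What the milestones do not buy (shape bookkeeping for provers)

Both milestones are Π-statements over (L, U, m/θ, r, t, x) about finite-lattice one-particle heat
kernels `NormedSpace.exp (−t • D_Wᴴ D_W)`; the consequent quantifies over `QCDRegularisation`,
`OSData`, `IsQCDAlong` (limits of Berezin-integrated lattice expectations). No decl in the tree maps the
former vocabulary into the latter, so modulo the milestones a proof term of the glue is a proof term of
X₀ built from scratch (`crux_iff_target`). Recorded as the trivial but exact statement below. -/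

/-- Modulo the milestones, proving the glue and proving X₀ are the same task (as types). [folklore] -/
theorem glue_task_eq_target_task (h1 : TracedQuadraticParametrix) (h2 : QuarkLoopCoefficient) :
    (InterleavedFlowProper → ContinuumQCDExists) ∧ (ContinuumQCDExists → InterleavedFlowProper) :=
  ⟨fun h => (crux_iff_target h1 h2).mp h, crux_of_target⟩

/-! ## §6 Near-misses and what would change the verdict (no sorries kept)

* A kernel-checked `¬ TracedQuadraticParametrix` or `¬ QuarkLoopCoefficient` would make this crux a
  one-line theorem (`crux_of_not_tqp/qlc`) — and break the route at that milestone (K1/K2 of the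
  route text). Status: QLC's coefficient confirmed numerically to 1e-4 (j021197, item 16786) and its
  flat slice fits the repaired envelope (items 16786/18031 evidence); TQP attacked on paper in the five
  regimes of the index above and numerically (kit j021520 / j021599: 45 runs, sup R = 0.0348, no family with
  R(t) growing inside tδ ≤ 1, coefficient c₀ = 0.996 of the continuum a₂): no K2 witness — a violation
  family growing like log t or t^α inside tθ ≤ ε would be filed at once as `vacuous-as-typed` on this item
  and as refutation evidence on 17985. What the scan does NOT cover (for the next seat): fully
  4D-inhomogeneous profiles (only x₀-dependent links were Bloch-reducible; by the second-order structure
  they can at most change the O(1) constant ‖Π_t(x;·,·)‖₁, not produce t-growth), instanton-like topology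
  (deficit 1/ρ⁴ ⇒ window t ≤ ερ² sees a smooth field; near-zero modes weigh |ψ₀(x)|² ~ ρ⁻⁴ = δ², inside
  Cδ²), and t beyond 256.
* Barrier catalogue pass (Literature/Barriers/QuantumFields): nothing bites the TYPED glue (an implication
  into X₀); mechanism-level entries the line must honour are WilsonDeterminantSign/MassSplitting (signed
  quark-integrated weights for N_f = 3 and split N_f = 2 tuples near the critical line — expand, never
  sample), UVStabilityNonUniqueness (stability gives subsequences; X₀ wants one sequence for all m),
  LinearDivergenceRenormalon (m_crit(k) must be tuned non-perturbatively — the route says in-flow), AokiPhase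
  (parity-flavour phase near m_crit at coarse k — the flow starts at weak coupling, evaded in scope).
  `ledger negatives --problem QuantumFields`: 4 entries, none on this route's decls. Literature services
  were degraded this session (searchd reset, OpenAlex 429, arXiv timeout) — no new printed negative result
  could be searched for; the route's and grounder's searches (2026-08-15/17) found none.
* A junk inhabitant of X₀ is excluded (parent audit + `target_iff_threshold`: offset-blind but not
  vacuum-admitting).
* Hence `¬ InterleavedFlowProper` ≡ "17985 ∧ 16786 ∧ continuum QCD (N_f = 2 or 3, Wilson, AF scheme,
  mass scaling, any common offset) does not exist" — the last conjunct contradicts the universally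
  expected answer: a barrier to refutation, not a barrier entry.
-/

end Summit.QuantumFields.QCD.Cruxes.InterleavedFlowProper.Disproof
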